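import Summits.QuantumFields.YangMills.Theorems.FluctuationComparisonRegPrIntLS2BetaLiftLadderCombRow
import Summits.QuantumFields.YangMills.Theorems.FluctuationComparisonRegPrIntLS2BetaReadNesting
import Summits.QuantumFields.YangMills.Theorems.UnitScaleTiltFluctuationComparisonRegPrGlobalSlackKernelLegAnchorCoherent
import Summits.QuantumFields.YangMills.Theorems.FluctuationComparisonRegPrIntLS2BetaSupTowerOfLiftLadderNested
import Literature.MathematicalPhysics.QuantumFieldTheory.Balaban1983to89.T3TiltDescent
import HarnessLib

/-!
# S2β · THE SUP CHAIN, (LIFT-LAD′) — THE COMB ROW AT THE TOWER: truncated Pi-sup edition in one `Params`, and the `descendTo` ∕ `siteShift` dictionary that carries it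
# to the T³ family's descended pair, and COMB-ROW′ in FILE 3″'s binder (FILE B of the px12 lineage's (LIFT-LAD′) discharger; FILE A = ✓p831211 `…S2BetaLiftLadderCombRow`)

Cell `ym3-torus` (YM ladder rung R3 = continuum `SU(2)` Yang–Mills on the three-torus at fixed lattice data — a RUNG: NOT d = 4, NOT infinite volume, NOT a mass gap,
NOT Clay).  Width seat «width 12» `ym3-torus-px12` (gen 26), FREE px helper on crux `stmt-QuantumFields-20520`; LINE g18-1 S2β, sup chain (UV3-NODE §94.5):
(ST′) ⟸ {(TOP-LAD′), COMB-ROW′, NC-ROW′, (SCT′-c)} (px10 g25 FILE 3′∕3″ over px17 g22 ✓p830137).  `--kind proof --supports stmt-QuantumFields-20520 --as helper`,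
count-neutral, DEFINITION-FREE (0 `def`, 0 `instance`, 0 `notation`, 0 `sorry`, default heartbeats).

WHAT IS PROVED (sorry-free).
§1 ★★ `sq_pi_norm_trunc_le_of_treeComb` — ONE `Params`, levels `j`∕`j+1`: for ANY bond predicates `pS` (fine) ∕ `pT` (coarse) with (a) every `pS`-bond a tree-comb bond,
   (b) the hat feeders of `pS`-bonds inside `pT` (READ′ nesting, ✓p830803 §3 supplies it for `pS := READ′_{t+1}(B) ∧ comb`, `pT := READ′_t(B)`), (c) arcs of the two
   level-`(j+1)` STAGE fields `≤ σ ≤ 1∕4` on `pT` (the lane's sup-profile letter — HYPOTHESIS), `2 ≤ L`, and the `AxStage` clause texts: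
   `‖𝟙_{pS}·logVec η_raw⁽ʲ⁾‖² ≤ ((11∕10)·L⁻¹)²·‖𝟙_{pT}·logVec η_raw⁽ʲ⁺¹⁾‖²` (FILE A ★`…_le_eleven_tenths` ∘ ★`sq_pi_norm_trunc_le_of_row`).
§2 THE DICTIONARY to the T³ family ([folklore] over lit `T3LevelShift`∕`T3TiltDescent`): `descendTo_apply_eq_iter` (`descendTo F ℰ n K U ℓ′ = M^{K−n}U (σ ℓ′)`, `rfl`) and its
   index-transported twin `descendTo_apply_eq_iter_of_eq` (any `a = K − n`); ★`treeComb_siteShift` — the tree-comb predicate `hblk ∧ hlo` is INVARIANT under the level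
   identification (lit ✓`siteShift_shift`∕`siteShift_blockOf`∕`siteShift_emb` + ✓`rel_siteShift`); `natAbs_rel_siteShift` (thickness-2 witnesses transport).
§3 ★★ `read'_nest_of_feeds` — THE READ′ NESTING ACROSS THE FAMILY: a bond `ℓ″` of `F.P (n+1)` (level 0) with a READ′-type witness `z` (`|rel z ℓ″.src|_ν ≤ 2`) and a hat
   feeder `e` of its `F.P K`-copy (internal level `K−(n+1)`) give the `F.P n`-copy `ℓ′` of `e` the witness `y := σ⁻¹(blockOf z)` with `|rel y ℓ′.src|_ν ≤ 2` and
   `blockOf z = σ y` (the hypothesis shape of px10 g25's ✓p831146 `blockIter_succ_eq_siteShift`) — the two conjuncts the READ′ clause needs, per `B`.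
§4 ★★★ `combRow'` — **COMB-ROW′**, the hypothesis `hCOMB` of px10 g25's FILE 3″ `…S2BetaSupTowerOfLiftLadderNestedSplit.supTower_of_combNcRowsFb₃'` VERBATIM with
   `A := (11∕10·L⁻¹)²` (`A·L = 1.21∕L ≤ ½` for `L ≥ 3`): for the pair `(expPoint ζ • U₀, U₀)`, from the `AxStage` witness clauses (texts as in ✓p830018's `hSTL`), `2 ≤ L`, and
   THE ARC PROFILE `σ ≤ 1∕4` of the two stage towers at the internal heights `1 ≤ i < K − J` (the lane's sup-profile letter — a HYPOTHESIS; its START at the top is the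
   D-GUARD ∕ (L♭)-start item of UV3-NODE §84.9 ∕ §97), `Σ_B ‖𝟙_{READ′_{t+1}(B) ∧ comb}·logVec η⁽ᴶ⁺ᵗ⁺²⁾‖² ≤ (11∕10·L⁻¹)²·Σ_B ‖𝟙_{READ′_t(B)}·logVec η⁽ᴶ⁺ᵗ⁺¹⁾‖²` for every
   `t + 1 < K − J` — §1 at heights `K−J−t−2 ∕ K−J−t−1` of `F.P K` through §2, feeders inside `READ′_t(B)` by §3 + ✓`blockIter_succ_eq_siteShift`.

HONEST SCOPE.  Plumbing: group algebra and lattice bookkeeping over landed letters by name; the arc profile `σ ≤ 1∕4` and every analytic letter are HYPOTHESES; nothing of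
Bałaban's renormalisation-group analysis is asserted or proved ([Balaban1985RegularSpaces] (1.19) p.79, (1.29) p.81; [Balaban1985Averaging] Prop. 4 (128)–(135) pp.37–38;
[Balaban1987RG1] (0.1)–(0.4), (0.11) pp.251–253 are the printed conventions); (TOP-LAD′), NC-ROW′, (SCT′),
(ST′)∕(ST), LOC, GAP♯∘ (`stub_uniformFibreGapOrbit`, registry 3732b7df UNTOUCHED), the five registered stubs (0∕5), S2β, 20520, 19936, 19200, `YM3TorusSU2` are NOT
proved; no registered stub is closed; rung R3 — NOT d = 4, NOT infinite volume, NOT a mass gap, NOT Clay; the Yang–Mills mass gap is NOT proved.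
-/

set_option autoImplicit false

namespace Summit.QuantumFields.YangMills.Theorems.FluctuationComparisonRegPrIntLS2BetaLiftLadderCombRowTower

open Finset
open scoped Real
open Literature.MathematicalPhysics.QuantumLattice (su2Quat)
open Literature.MathematicalPhysics.QuantumFieldTheory.Balaban1983to89
open T4Continuum T3ContinuumYM3Torus T3TiltDescent T3LevelShift BlockAveraging
open B10Eq27TorusAxialLog (rel axialT)
open T4CubeChartGnomonic (SU2)
open T4HaarSU2ExpChart (expPoint)
open T4ExpWindowSmallField (logVec)
open Summit.QuantumFields.YangMills.Theorems.FluctuationComparisonRegPrIntLS2BetaLiftLadderCombRow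
  (norm_logVec_rawChord_treeComb_le_eleven_tenths sq_pi_norm_trunc_le_of_row)
open Summit.QuantumFields.YangMills.Theorems.FluctuationComparisonRegPrIntLS2BetaReadNesting (natAbs_rel_blockOf_src_le_two)
open Summit.QuantumFields.YangMills.Theorems.GlobalSlackKernelLeg (rel_siteShift)

/-! ## §1 The truncated Pi-sup comb row in one `Params` -/

section OneParams

variable {P : Params}

/-- ★★ **COMB ROW OF THE TRUNCATED SUP NORMS, ONE `Params`** (levels `j` fine ∕ `j+1` coarse; `AxStage` clause texts as in FILE A §2; ANY bond predicates `pS`, `pT`):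
if every `pS`-bond is a tree-comb bond whose hat feeders satisfy `pT`, the two level-`(j+1)` stage fields have arcs `≤ σ ≤ 1∕4` on `pT`, and `2 ≤ L`, then
`‖𝟙_{pS}·logVec η_raw⁽ʲ⁾‖² ≤ ((11∕10)·L⁻¹)²·‖𝟙_{pT}·logVec η_raw⁽ʲ⁺¹⁾‖²` (Pi-sup norms of the truncated relative-log fields of the RAW pair `(M^jU, M^jU₀)`).
[cite: Balaban1985RegularSpaces, (1.29) p.81; Balaban1985Averaging, Prop. 4 (128)-(135) p.37-38] -/
theorem sq_pi_norm_trunc_le_of_treeComb (av : ∀ i, Averaging P i SU2) {j : ℕ} (hj : j + 1 ≤ P.m + P.K)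
    (wt : (i : ℕ) → PBond P i → PBond P (i + 1) → ℝ) (lift : (i : ℕ) → GaugeField P (i + 1) SU2 → GaugeField P i SU2)
    (g g₀ : (i : ℕ) → Site P i → SU2) (U U₁ U₀ : GaugeField P 0 SU2)
    (hwt : ∀ b e, wt j b e = if e.dir = b.dir ∧ (b.src b.dir - emb e.src b.dir).val < P.L then
      ∏ ν ∈ Finset.univ.erase b.dir, max 0 (1 - ((rel (emb e.src) b.src ν).natAbs : ℝ) / P.L) else 0)
    (hlift : ∀ (X : GaugeField P (j + 1) SU2) (b : PBond P j), lift j X b = expPoint (∑ e, wt j b e • ((P.L : ℝ)⁻¹ • logVec (su2Quat (X e)))))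
    (hT3 : ∀ X : GaugeField P 0 SU2, Averaging.iter av j (GaugeField.gaugeAct (g 0) X) = GaugeField.gaugeAct (g j) (Averaging.iter av j X))
    (hT3s : ∀ X : GaugeField P 0 SU2, Averaging.iter av (j + 1) (GaugeField.gaugeAct (g 0) X) = GaugeField.gaugeAct (g (j + 1)) (Averaging.iter av (j + 1) X))
    (hT3' : ∀ X : GaugeField P 0 SU2, Averaging.iter av j (GaugeField.gaugeAct (g₀ 0) X) = GaugeField.gaugeAct (g₀ j) (Averaging.iter av j X))
    (hT3s' : ∀ X : GaugeField P 0 SU2, Averaging.iter av (j + 1) (GaugeField.gaugeAct (g₀ 0) X) = GaugeField.gaugeAct (g₀ (j + 1)) (Averaging.iter av (j + 1) X))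
    (hU₀ : U₀ = GaugeField.gaugeAct (fun x => (g 0 x)⁻¹ * g₀ 0 x) U₁)
    (hT4 : ∀ x, axialT (GaugeField.gaugeAct (g j) (Averaging.iter av j U)) (emb (blockOf x)) x =
      axialT (lift j (GaugeField.gaugeAct (g (j + 1)) (Averaging.iter av (j + 1) U))) (emb (blockOf x)) x)
    (hT4' : ∀ x, axialT (GaugeField.gaugeAct (g₀ j) (Averaging.iter av j U₁)) (emb (blockOf x)) x =
      axialT (lift j (GaugeField.gaugeAct (g₀ (j + 1)) (Averaging.iter av (j + 1) U₁))) (emb (blockOf x)) x)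
    (hL2 : 2 ≤ P.L) {σ : ℝ} (hσ4 : σ ≤ 1 / 4)
    (pS : PBond P j → Prop) [DecidablePred pS] (pT : PBond P (j + 1) → Prop) [DecidablePred pT]
    (hcomb : ∀ b, pS b → blockOf (b.src.shift b.dir) = blockOf b.src ∧ ∀ ν, ν < b.dir → rel (emb (blockOf b.src)) b.src ν = 0)
    (hnest : ∀ b, pS b → ∀ e, wt j b e ≠ 0 → pT e)
    (hσ : ∀ e, pT e → ‖logVec (su2Quat (GaugeField.gaugeAct (g (j + 1)) (Averaging.iter av (j + 1) U) e))‖ ≤ σ)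
    (hσ' : ∀ e, pT e → ‖logVec (su2Quat (GaugeField.gaugeAct (g₀ (j + 1)) (Averaging.iter av (j + 1) U₁) e))‖ ≤ σ) :
    ‖(fun b : PBond P j => if pS b then logVec (su2Quat (Averaging.iter av j U b * (Averaging.iter av j U₀ b)⁻¹)) else 0)‖ ^ 2 ≤
      (11 / 10 * (P.L : ℝ)⁻¹) ^ 2 *
        ‖(fun e : PBond P (j + 1) => if pT e then logVec (su2Quat (Averaging.iter av (j + 1) U e * (Averaging.iter av (j + 1) U₀ e)⁻¹)) else 0)‖ ^ 2 := by
  refine sq_pi_norm_trunc_le_of_row pS pT (fun b e => wt j b e ≠ 0)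
    (fun b => logVec (su2Quat (Averaging.iter av j U b * (Averaging.iter av j U₀ b)⁻¹)))
    (fun e => logVec (su2Quat (Averaging.iter av (j + 1) U e * (Averaging.iter av (j + 1) U₀ e)⁻¹)))
    (by positivity) (fun b hb m hm => ?_) hnest
  obtain ⟨hblk, hlo⟩ := hcomb b hb
  have h := norm_logVec_rawChord_treeComb_le_eleven_tenths av hj wt lift g g₀ U U₁ U₀ hwt hlift hT3 hT3s hT3' hT3s' hU₀ hT4 hT4'
    b.src b.dir hblk hlo hL2 hσ4 (fun e he => hσ e (hnest b hb e he)) (fun e he => hσ' e (hnest b hb e he)) hm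
  calc ‖logVec (su2Quat (Averaging.iter av j U b * (Averaging.iter av j U₀ b)⁻¹))‖
      = ‖logVec (su2Quat (Averaging.iter av j U ⟨b.src, b.dir⟩ * (Averaging.iter av j U₀ ⟨b.src, b.dir⟩)⁻¹))‖ := rfl
    _ ≤ 11 / 10 * ((P.L : ℝ)⁻¹ * m) := h
    _ = 11 / 10 * (P.L : ℝ)⁻¹ * m := by ring

end OneParams

/-! ## §2 The dictionary to the T³ family: `descendTo` reads the internal tower, the tree-comb predicate and the thickness-2 witnesses are level-identification invariant -/

section Dictionary

variable (F : T3Family)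

/-- **`descendTo` READS THE INTERNAL TOWER OF THE FINEST `Params`** (lit `descendTo` ≝ `fieldShift ∘ M^{K−n}`): `D_{n,K} U ℓ′ = M^{K−n}U (σ ℓ′)`. [cite: Balaban1987RG1, (0.11) p.253] -/
theorem descendTo_apply_eq_iter {n K : ℕ} (h : n ≤ K) (U : GaugeField (F.P K) 0 SU2) (ℓ' : PBond (F.P n) 0) :
    descendTo F T3UnitLawDensityEML.ℰp n K h U ℓ' =
      Averaging.iter (fun i => blockAvg (P := F.P K) (j := i) T3UnitLawDensityEML.ℰp) (K - n) U
        (bondShift (F.sitesPerDir_eq (m := F.m) (K := n) (j := 0) (m' := F.m) (K' := K) (j' := K - n) (by omega)) ℓ') :=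
  rfl

/-- The same with the internal height written as ANY `a = K − n` (index transport by `subst`; the `bondShift` proof term follows). [cite: Balaban1987RG1, (0.11) p.253] -/
theorem descendTo_apply_eq_iter_of_eq {n K : ℕ} (h : n ≤ K) {a : ℕ} (ha : a = K - n) (U : GaugeField (F.P K) 0 SU2) (ℓ' : PBond (F.P n) 0) :
    descendTo F T3UnitLawDensityEML.ℰp n K h U ℓ' =
      Averaging.iter (fun i => blockAvg (P := F.P K) (j := i) T3UnitLawDensityEML.ℰp) a U
        (bondShift (F.sitesPerDir_eq (m := F.m) (K := n) (j := 0) (m' := F.m) (K' := K) (j' := a) (by omega)) ℓ') := by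
  subst ha
  rfl

variable {F}

/-- ★ **THE TREE-COMB PREDICATE IS INVARIANT UNDER THE LEVEL IDENTIFICATION**: `hblk ∧ hlo` for `x` at level `j` of `F.PP m K` ⟹ the same for `σ x` at level `j′` of
`F.PP m′ K′` (lit ✓`siteShift_shift`, ✓`siteShift_blockOf`, ✓`siteShift_emb`; ✓`rel_siteShift`). [cite: Balaban1987RG1, (0.1)-(0.4) p.251-253; Balaban1985RegularSpaces, (1.19) p.79] -/
theorem treeComb_siteShift {m K j m' K' j' : ℕ} (h₀ : (F.PP m K).sitesPerDir j = (F.PP m' K').sitesPerDir j')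
    (h₁ : (F.PP m K).sitesPerDir (j + 1) = (F.PP m' K').sitesPerDir (j' + 1)) (x : Site (F.PP m K) j) (μ : Fin 3)
    (hblk : blockOf (x.shift μ) = blockOf x) (hlo : ∀ ν, ν < μ → rel (emb (blockOf x)) x ν = 0) :
    blockOf ((siteShift h₀ x).shift μ) = blockOf (siteShift h₀ x) ∧ ∀ ν, ν < μ → rel (emb (blockOf (siteShift h₀ x))) (siteShift h₀ x) ν = 0 := by
  refine ⟨?_, fun ν hν => ?_⟩
  · rw [← siteShift_shift, ← siteShift_blockOf h₀ h₁, ← siteShift_blockOf h₀ h₁, hblk]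
  · rw [← siteShift_blockOf h₀ h₁, ← siteShift_emb h₀ h₁, rel_siteShift]
    exact hlo ν hν

/-- Thickness-2 witnesses transport: `|rel (σ y) (σ x)|_ν = |rel y x|_ν`. [cite: Balaban1987RG1, (0.1) p.251] -/
theorem natAbs_rel_siteShift {m K j m' K' j' : ℕ} (h : (F.PP m K).sitesPerDir j = (F.PP m' K').sitesPerDir j') (y x : Site (F.PP m K) j) (ν : Fin 3) :
    (rel (siteShift h y) (siteShift h x) ν).natAbs = (rel y x ν).natAbs := by
  rw [rel_siteShift]

/-- `siteShift` along `h` then along `h.symm` is the identity. [cite: Balaban1987RG1, (0.1) p.251] -/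
theorem siteShift_symm_siteShift {m K j m' K' j' : ℕ} (h : (F.PP m K).sitesPerDir j = (F.PP m' K').sitesPerDir j') (x : Site (F.PP m K) j) :
    siteShift h.symm (siteShift h x) = x := by
  rw [siteShift_siteShift, siteShift_refl]

/-- `siteShift` along `h.symm` then along `h` is the identity. [cite: Balaban1987RG1, (0.1) p.251] -/
theorem siteShift_siteShift_symm {m K j m' K' j' : ℕ} (h : (F.PP m K).sitesPerDir j = (F.PP m' K').sitesPerDir j') (x : Site (F.PP m' K') j') :
    siteShift h (siteShift h.symm x) = x := by
  rw [siteShift_siteShift, siteShift_refl]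

end Dictionary

/-! ## §3 READ′ nesting across the family: the witness one family down -/

section Nesting

variable {F : T3Family}

/-- ★★ **READ′ NESTING ACROSS THE FAMILY, PER BOND.**  Levels: the fine bond `ℓ″` lives at level `0` of `F.P (n+1)`, its `F.P K`-copy `σ₂ ℓ″` at internal height `s`
(`hs : F.m + (n+1) + s = F.m + K + 0`, i.e. `s = K − (n+1)`); the coarse bond `ℓ′` lives at level `0` of `F.P n`, its copy `σ₁ ℓ′` at height `s+1`.  If `z` is a
thickness-2 witness for `ℓ″` (`∀ ν, |rel z ℓ″.src|_ν ≤ 2`) and `σ₁ ℓ′` is a hat feeder of `σ₂ ℓ″` (`wt s (σ₂ ℓ″) (σ₁ ℓ′) ≠ 0`, hat-weight formula at height `s`), then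
`y := σ⁻¹(blockOf z)` (level `0` of `F.P n`) satisfies `blockOf z = σ y` (the hypothesis shape of px10's ✓`blockIter_succ_eq_siteShift`) and `∀ ν, |rel y ℓ′.src|_ν ≤ 2`
(✓p830803 `natAbs_rel_blockOf_src_le_two` in `F.P K`, carried by ✓`rel_siteShift` ∕ lit ✓`siteShift_blockOf`). [cite: Balaban1985RegularSpaces, (1.29) p.81; Balaban1987RG1, (0.1)-(0.4) p.251-253] -/
theorem read'_nest_of_feeds {n K s : ℕ} (hs : F.m + (n + 1) + s = F.m + K + 0) (hs1 : F.m + n + (s + 1) = F.m + K + 0)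
    (hsK : s + 1 ≤ (F.P K).m + (F.P K).K)
    (w : PBond (F.P K) s → PBond (F.P K) (s + 1) → ℝ)
    (hw : ∀ b e, w b e = if e.dir = b.dir ∧ (b.src b.dir - emb e.src b.dir).val < (F.P K).L then
      ∏ ν ∈ Finset.univ.erase b.dir, max 0 (1 - ((rel (emb e.src) b.src ν).natAbs : ℝ) / (F.P K).L) else 0)
    (ℓ'' : PBond (F.P (n + 1)) 0) (ℓ' : PBond (F.P n) 0)
    (hfeed : w (bondShift (F.sitesPerDir_eq hs) ℓ'') (bondShift (F.sitesPerDir_eq hs1) ℓ') ≠ 0)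
    {z : Site (F.P (n + 1)) 0} (hz : ∀ ν, (rel z ℓ''.src ν).natAbs ≤ 2) :
    blockOf z = siteShift (F.sitesPerDir_eq (m := F.m) (K := n) (j := 0) (m' := F.m) (K' := n + 1) (j' := 1) (by omega))
        (siteShift (F.sitesPerDir_eq (m := F.m) (K := n) (j := 0) (m' := F.m) (K' := n + 1) (j' := 1) (by omega)).symm (blockOf z)) ∧
      ∀ ν, (rel (siteShift (F.sitesPerDir_eq (m := F.m) (K := n) (j := 0) (m' := F.m) (K' := n + 1) (j' := 1) (by omega)).symm (blockOf z)) ℓ'.src ν).natAbs ≤ 2 := by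
  refine ⟨(siteShift_siteShift_symm _ _).symm, fun ν => ?_⟩
  -- carry everything to `F.P K`, heights `s` and `s+1`
  have hs1' : (F.PP F.m (n + 1)).sitesPerDir 1 = (F.PP F.m K).sitesPerDir (s + 1) := F.sitesPerDir_eq (by omega)
  -- the witness in `F.P K`
  have hzK : ∀ κ, (rel (siteShift (F.sitesPerDir_eq hs) z) (bondShift (F.sitesPerDir_eq hs) ℓ'').src κ).natAbs ≤ 2 := fun κ => by
    rw [bondShift_src, natAbs_rel_siteShift]; exact hz κ
  have hK := natAbs_rel_blockOf_src_le_two hsK w hw hfeed hzK ν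
  rw [bondShift_src] at hK
  -- read the target through `σ₁` (height `s+1` of `F.P K`): `σ₁ (σ⁻¹ (blockOf z)) = σ₁′ (blockOf z) = blockOf (σ₀ z)` (`erw`: `F.P K` unfolds to `F.PP F.m K`)
  rw [← natAbs_rel_siteShift (F.sitesPerDir_eq hs1), siteShift_siteShift]
  erw [siteShift_blockOf (F.sitesPerDir_eq hs) hs1' z]
  exact hK

end Nesting


/-! ## §4 COMB-ROW′ in FILE 3″'s binder (px10 g25 ✓`…S2BetaSupTowerOfLiftLadderNestedSplit.supTower_of_combNcRowsFb₃'`, hypothesis `hCOMB` VERBATIM with `A := (11∕10·L⁻¹)²`) -/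

section CombRow

variable {F : T3Family}

open T3UnitLawDensityEML (ℰp)
open Summit.QuantumFields.YangMills.Theorems.FluctuationComparisonRegPrIntLS2BetaSupTowerOfLiftLadderNested (blockIter_succ_eq_siteShift)

/-- ★★★ **COMB-ROW′ — THE COMB ROW OF (LIFT-LAD′) FOR THE DESCENDED PAIR `(D_{J+t+2,K}(expPoint ζ • U₀), D_{J+t+2,K} U₀)` ON THE THICKENED READ SETS, SUMMED OVER THE
COARSEST BONDS** — the hypothesis `hCOMB` of px10 g25's `supTower_of_combNcRowsFb₃'` VERBATIM with `A := (11∕10·L⁻¹)²` (`A·L = 1.21∕L ≤ ½` for `L ≥ 3`), from: the `AxStage`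
witness clauses for the pair (hat weights, hat lift, (T3)×2, (T4)×2, the bottom relation — texts as in ✓p830018's `hSTL`), `2 ≤ L`, and THE ARC PROFILE of the two stage towers
(`σ ≤ 1∕4` at every internal height `1 ≤ i < K − J` — the lane's sup-profile letter, a HYPOTHESIS here).  Per `B`: §1 in `F.P K` at heights `K−J−t−2 ∕ K−J−t−1` through the
dictionary §2, feeders inside `READ′_t(B)` by §3 + ✓p831146 `blockIter_succ_eq_siteShift`. [cite: Balaban1985RegularSpaces, (1.29) p.81; Balaban1985Averaging, Prop. 4 (128)-(135) p.37-38; Balaban1987RG1, (0.4), (0.11) p.253] -/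
theorem combRow' {J K : ℕ} (hJK : J ≤ K) (U₀ : GaugeField (F.P K) 0 (Matrix.specialUnitaryGroup (Fin 2) ℂ)) (ζ : PBond (F.P K) 0 → EuclideanSpace ℝ (Fin 3))
    (wt : (j : ℕ) → PBond (F.P K) j → PBond (F.P K) (j + 1) → ℝ)
    (lift : (j : ℕ) → GaugeField (F.P K) (j + 1) SU2 → GaugeField (F.P K) j SU2)
    (U₁ : GaugeField (F.P K) 0 SU2) (g g₀ : (j : ℕ) → Site (F.P K) j → SU2)
    (hwt : ∀ j b e, wt j b e = if e.dir = b.dir ∧ (b.src b.dir - emb e.src b.dir).val < (F.P K).L then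
        ∏ ν ∈ Finset.univ.erase b.dir, max 0 (1 - ((rel (emb e.src) b.src ν).natAbs : ℝ) / (F.P K).L) else 0)
    (hlift : ∀ j X b, lift j X b = expPoint (∑ e, wt j b e • ((((F.P K).L : ℕ) : ℝ)⁻¹ • logVec (su2Quat (X e)))))
    (hT3 : ∀ X : GaugeField (F.P K) 0 SU2, ∀ j, j ≤ K - J →
      Averaging.iter (fun k => blockAvg (P := F.P K) (j := k) ℰp) j (GaugeField.gaugeAct (g 0) X) =
        GaugeField.gaugeAct (g j) (Averaging.iter (fun k => blockAvg (P := F.P K) (j := k) ℰp) j X))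
    (hT4 : ∀ j, j < K - J → ∀ x,
      axialT (GaugeField.gaugeAct (g j) (Averaging.iter (fun k => blockAvg (P := F.P K) (j := k) ℰp) j (fun ℓ => expPoint (ζ ℓ) * U₀ ℓ))) (emb (blockOf x)) x =
        axialT (lift j (GaugeField.gaugeAct (g (j + 1)) (Averaging.iter (fun k => blockAvg (P := F.P K) (j := k) ℰp) (j + 1) (fun ℓ => expPoint (ζ ℓ) * U₀ ℓ))))
          (emb (blockOf x)) x)
    (hT3' : ∀ X : GaugeField (F.P K) 0 SU2, ∀ j, j ≤ K - J →
      Averaging.iter (fun k => blockAvg (P := F.P K) (j := k) ℰp) j (GaugeField.gaugeAct (g₀ 0) X) =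
        GaugeField.gaugeAct (g₀ j) (Averaging.iter (fun k => blockAvg (P := F.P K) (j := k) ℰp) j X))
    (hT4' : ∀ j, j < K - J → ∀ x,
      axialT (GaugeField.gaugeAct (g₀ j) (Averaging.iter (fun k => blockAvg (P := F.P K) (j := k) ℰp) j U₁)) (emb (blockOf x)) x =
        axialT (lift j (GaugeField.gaugeAct (g₀ (j + 1)) (Averaging.iter (fun k => blockAvg (P := F.P K) (j := k) ℰp) (j + 1) U₁)))
          (emb (blockOf x)) x)
    (hU₀ : U₀ = GaugeField.gaugeAct (fun x => (g 0 x)⁻¹ * g₀ 0 x) U₁)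
    (hL2 : 2 ≤ F.L) {σ : ℝ} (hσ4 : σ ≤ 1 / 4)
    (hArc : ∀ i, 1 ≤ i → i < K - J → ∀ e : PBond (F.P K) i,
      ‖logVec (su2Quat (GaugeField.gaugeAct (g i) (Averaging.iter (fun k => blockAvg (P := F.P K) (j := k) ℰp) i (fun ℓ => expPoint (ζ ℓ) * U₀ ℓ)) e))‖ ≤ σ ∧
      ‖logVec (su2Quat (GaugeField.gaugeAct (g₀ i) (Averaging.iter (fun k => blockAvg (P := F.P K) (j := k) ℰp) i U₁) e))‖ ≤ σ) :
    ∀ (t : ℕ) (ht1 : t + 1 < K - J),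
      (fun (t : ℕ) (ht : t < K - J) => ∑ B : PBond (F.P J) 0,
            ‖(fun ℓ' : PBond (F.P (J + (t + 1))) 0 =>
              if (∃ z : Site (F.P (J + (t + 1))) 0,
                (B14.Eq22Determines.blockIter (t + 1) z = (bondShift (F.sitesPerDir_eq (m := F.m) (K := J) (j := 0) (m' := F.m) (K' := J + (t + 1)) (j' := t + 1) (by omega)) B).src ∨ B14.Eq22Determines.blockIter (t + 1) z = (bondShift (F.sitesPerDir_eq (m := F.m) (K := J) (j := 0) (m' := F.m) (K' := J + (t + 1)) (j' := t + 1) (by omega)) B).tgt) ∧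
                ∀ ν, (B10Eq27TorusAxialLog.rel z ℓ'.src ν).natAbs ≤ 2) ∧
                (blockOf (ℓ'.src.shift ℓ'.dir) = blockOf ℓ'.src ∧ ∀ ν, ν < ℓ'.dir → B10Eq27TorusAxialLog.rel (emb (blockOf ℓ'.src)) ℓ'.src ν = 0)
              then logVec (su2Quat (descendTo F ℰp (J + (t + 1)) K (by omega) (fun ℓ => expPoint (ζ ℓ) * U₀ ℓ : GaugeField (F.P K) 0 (Matrix.specialUnitaryGroup (Fin 2) ℂ)) ℓ' * (descendTo F ℰp (J + (t + 1)) K (by omega) U₀ ℓ')⁻¹)) else 0)‖ ^ 2) (t + 1) ht1 ≤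
        (11 / 10 * (F.L : ℝ)⁻¹) ^ 2 * (fun (t : ℕ) (ht : t < K - J) => ∑ B : PBond (F.P J) 0,
            ‖(fun ℓ' : PBond (F.P (J + (t + 1))) 0 =>
              if ∃ z : Site (F.P (J + (t + 1))) 0,
                (B14.Eq22Determines.blockIter (t + 1) z = (bondShift (F.sitesPerDir_eq (m := F.m) (K := J) (j := 0) (m' := F.m) (K' := J + (t + 1)) (j' := t + 1) (by omega)) B).src ∨ B14.Eq22Determines.blockIter (t + 1) z = (bondShift (F.sitesPerDir_eq (m := F.m) (K := J) (j := 0) (m' := F.m) (K' := J + (t + 1)) (j' := t + 1) (by omega)) B).tgt) ∧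
                ∀ ν, (B10Eq27TorusAxialLog.rel z ℓ'.src ν).natAbs ≤ 2
              then logVec (su2Quat (descendTo F ℰp (J + (t + 1)) K (by omega) (fun ℓ => expPoint (ζ ℓ) * U₀ ℓ : GaugeField (F.P K) 0 (Matrix.specialUnitaryGroup (Fin 2) ℂ)) ℓ' * (descendTo F ℰp (J + (t + 1)) K (by omega) U₀ ℓ')⁻¹)) else 0)‖ ^ 2) t (Nat.lt_of_succ_lt ht1) := by
  have _h := hJK
  intro t ht1
  beta_reduce
  -- the internal heights of `F.P K`: fine `s = K − J − t − 2`, coarse `s + 1 = K − J − t − 1`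
  obtain ⟨s, hsd⟩ : ∃ s : ℕ, s = K - (J + (t + 1 + 1)) := ⟨_, rfl⟩
  have hs1d : s + 1 = K - (J + (t + 1)) := by omega
  have hsK : s + 1 ≤ (F.P K).m + (F.P K).K := by show s + 1 ≤ F.m + K; omega
  have hsle : s ≤ K - J := by omega
  have hs1le : s + 1 ≤ K - J := by omega
  have hslt : s < K - J := by omega
  have P₂ : (F.P (J + (t + 1 + 1))).sitesPerDir 0 = (F.P K).sitesPerDir s := F.sitesPerDir_eq (by omega)
  have P₁ : (F.P (J + (t + 1))).sitesPerDir 0 = (F.P K).sitesPerDir (s + 1) := F.sitesPerDir_eq (by omega)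
  have Q₁ : (F.P (J + (t + 1 + 1))).sitesPerDir 1 = (F.P K).sitesPerDir (s + 1) := F.sitesPerDir_eq (by omega)
  have hL2' : 2 ≤ (F.P K).L := hL2
  -- constant out of the sum, then bond set by bond set
  rw [Finset.mul_sum]
  refine Finset.sum_le_sum fun B _ => ?_
  refine sq_pi_norm_trunc_le_of_row _ _ (fun ℓ'' ℓ' => wt s (bondShift P₂ ℓ'') (bondShift P₁ ℓ') ≠ 0) _ _ (by positivity)
    (fun ℓ'' hS m hm => ?_) (fun ℓ'' hS ℓ' hfe => ?_)
  · -- THE ROW PER BOND (FILE A ★`…_le_eleven_tenths` at heights `s ∕ s+1` of `F.P K`, through the dictionary)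
    obtain ⟨_, hblk, hlo⟩ := hS
    obtain ⟨hblk', hlo'⟩ := treeComb_siteShift P₂ Q₁ ℓ''.src ℓ''.dir hblk hlo
    rw [descendTo_apply_eq_iter_of_eq F (n := J + (t + 1 + 1)) (by omega) hsd (fun ℓ => expPoint (ζ ℓ) * U₀ ℓ) ℓ'',
      descendTo_apply_eq_iter_of_eq F (n := J + (t + 1 + 1)) (by omega) hsd U₀ ℓ'']
    have hmK : ∀ e : PBond (F.P K) (s + 1), wt s ⟨siteShift P₂ ℓ''.src, ℓ''.dir⟩ e ≠ 0 →
        ‖logVec (su2Quat (Averaging.iter (fun k => blockAvg (P := F.P K) (j := k) ℰp) (s + 1) (fun ℓ => expPoint (ζ ℓ) * U₀ ℓ) e *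
          (Averaging.iter (fun k => blockAvg (P := F.P K) (j := k) ℰp) (s + 1) U₀ e)⁻¹))‖ ≤ m := fun e he => by
      have h1 := hm ((bondShift P₁).symm e) (by rwa [Equiv.apply_symm_apply])
      rwa [descendTo_apply_eq_iter_of_eq F (n := J + (t + 1)) (by omega) hs1d (fun ℓ => expPoint (ζ ℓ) * U₀ ℓ),
        descendTo_apply_eq_iter_of_eq F (n := J + (t + 1)) (by omega) hs1d U₀, Equiv.apply_symm_apply] at h1
    have key := norm_logVec_rawChord_treeComb_le_eleven_tenths (fun k => blockAvg (P := F.P K) (j := k) ℰp) hsK wt lift g g₀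
      (fun ℓ => expPoint (ζ ℓ) * U₀ ℓ) U₁ U₀ (hwt s) (fun X b => hlift s X b) (fun X => hT3 X s hsle) (fun X => hT3 X (s + 1) hs1le)
      (fun X => hT3' X s hsle) (fun X => hT3' X (s + 1) hs1le) hU₀ (hT4 s hslt) (hT4' s hslt) (siteShift P₂ ℓ''.src) ℓ''.dir hblk' hlo' hL2' hσ4
      (fun e _ => (hArc (s + 1) (by omega) (by omega) e).1) (fun e _ => (hArc (s + 1) (by omega) (by omega) e).2) hmK
    have eL : (((F.P K).L : ℕ) : ℝ) = (F.L : ℝ) := rfl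
    rw [eL] at key
    calc ‖logVec (su2Quat (Averaging.iter (fun k => blockAvg (P := F.P K) (j := k) ℰp) s (fun ℓ => expPoint (ζ ℓ) * U₀ ℓ) (bondShift P₂ ℓ'') *
            (Averaging.iter (fun k => blockAvg (P := F.P K) (j := k) ℰp) s U₀ (bondShift P₂ ℓ''))⁻¹))‖
        ≤ 11 / 10 * ((F.L : ℝ)⁻¹ * m) := key
      _ = 11 / 10 * (F.L : ℝ)⁻¹ * m := by ring
  · -- THE FEEDERS LIE IN READ′_t(B) (§3 + ✓`blockIter_succ_eq_siteShift`)
    obtain ⟨⟨z, hzB, hz2⟩, _⟩ := hS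
    obtain ⟨hx, hy2⟩ := read'_nest_of_feeds (n := J + (t + 1)) (K := K) (s := s) (by omega) (by omega) hsK (wt s) (hwt s) ℓ'' ℓ' hfe hz2
    refine ⟨_, ?_, hy2⟩
    have H := blockIter_succ_eq_siteShift (K₁ := J + (t + 1)) _ z hx (t + 1)
    rcases hzB with h | h
    · left
      have e1 := H.symm.trans h
      rw [bondShift_src] at e1
      rw [bondShift_src]
      exact (siteShift _).injective (e1.trans (by rw [siteShift_siteShift]))
    · right
      have e1 := H.symm.trans h
      rw [bondShift_tgt] at e1
      rw [bondShift_tgt]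
      exact (siteShift _).injective (e1.trans (by rw [siteShift_siteShift]))

end CombRow

end Summit.QuantumFields.YangMills.Theorems.FluctuationComparisonRegPrIntLS2BetaLiftLadderCombRowTower
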